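import Literature.Analysis.OperatorTheory.FreePolydiscPositivstellensatz

/-!
# From a free certificate to a contractive determinantal representation

For an nc polynomial `P̂ ∈ ℂ⟨g_σ⟩` with constant term `1` and a free certificate
`P̂* P̂ - c²·1 ∈ 𝒞_free` (`FreePolydiscPositivstellensatz.lean`), the abelianisation `P = ab P̂ ∈ ℂ[z_σ]`
is `det(I - A Z)` with `A` a contraction and `Z = diag(z_{jj(n)})` (**`ab_eq_det_of_certificate`**).
This is the determinantal-representation step of [GrinshpanEtAl2015, Thm. 3.1], carried out freely:
unpack the certificate and run the lurking contraction (`lurking_contractionN`), read off the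
colligation blocks `d = c, β, γ, α` from the block equations, form the inverse state matrix
`A× = α - βγ/c`; comparing WORD coefficients in `(1 - A× Z) t = β` shows that `A×P_{u₁}⋯A×P_{u_k} β`
vanishes for long words, so on the graded `A×`-cyclic subspace the pencil `A×Π Z` is nilpotent
(`det_one_sub_eq_one_of_pow_eq_zero`) while the realization identities survive the compression by
the orthogonal projection `Π`; the rank-one determinant formula
(`det_sub_replicateCol_mul_replicateRow_of_mulVec_eq`) then gives `det(I - αΠ Z) = det(I - A×Π Z)·P = P`,
and `‖αΠ‖ ≤ ‖α‖ ≤ 1` (`norm_toEuclideanCLM_block_le`). Also: the abelianisation `ab : ℂ⟨g⟩ → ℂ[z]`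
and its coefficients (`coeff_ab`), `toEuclideanCLM_of_clm`. Grouping namespace `GKVVW`.

## References

* [GrinshpanEtAl2015] A. Grinshpan, D. S. Kaliuzhnyi-Verbovetskyi, V. Vinnikov, H. J. Woerdeman,
  Contractive determinantal representations of stable polynomials on a matrix polyball, Math. Z. 283
  (2016) 25–37 = arXiv:1503.06161, Thm. 3.1 (p. 8) and its proof.
* [GrinshpanEtAl2016] the same, Matrix-valued Hermitian Positivstellensatz, lurking contractions, and
  contractive determinantal representations of stable polynomials, Oper. Theory Adv. Appl. 255 (2016)
  123–136, Thm. 2.3 (Positivstellensatz), Thm. 3.4 (lurking contraction).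
-/

noncomputable section

namespace Literature.Analysis.OperatorTheory
namespace GKVVW

open MvPolynomial
open scoped ComplexConjugate NNReal

variable {σ : Type}

/-! ### Infrastructure for the free assembly -/

/-- Prefix decomposition of words: `g_a u = g_b v ↔ a = b ∧ u = v`. [folklore] -/
theorem FreeMonoid_of_mul_eq_of_mul_iff {a b : σ} {u v : FreeMonoid σ} :
    FreeMonoid.of a * u = FreeMonoid.of b * v ↔ a = b ∧ u = v := by
  constructor
  · intro h
    have h' := congrArg FreeMonoid.toList h
    rw [FreeMonoid.toList_of_mul, FreeMonoid.toList_of_mul, List.cons_eq_cons] at h'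
    exact ⟨h'.1, FreeMonoid.toList.injective h'.2⟩
  · rintro ⟨rfl, rfl⟩; rfl

/-- A word of positive length is not the empty word. [folklore] -/
theorem FreeMonoid_of_mul_ne_one (a : σ) (u : FreeMonoid σ) : FreeMonoid.of a * u ≠ 1 := by
  intro h
  have := congrArg FreeMonoid.length h
  rw [FreeMonoid.length_mul, FreeMonoid.length_of, FreeMonoid.length_one] at this
  omega

/-- **Abelianisation** `ℂ⟨g⟩ → ℂ[z]`, `g_j ↦ z_j`. [folklore] -/
def ab : NC σ →ₐ[ℂ] MvPolynomial σ ℂ := ncEval fun j => X j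

/-- `ab (g_j f) = z_j · ab f`. [folklore] -/
theorem ab_lmul (j : σ) (f : NC σ) : ab (lmul j f) = X j * ab f := by
  rw [lmul, map_mul, letter, ab, ncEval_single, one_smul, FreeMonoid.lift_eval_of]

/-- `ab 1 = 1`. [folklore] -/
theorem ab_one : ab (1 : NC σ) = 1 := map_one _

/-- The commutative exponent of a word. [folklore] -/
def abw : FreeMonoid σ →* Multiplicative (σ →₀ ℕ) :=
  FreeMonoid.lift fun j => Multiplicative.ofAdd (Finsupp.single j 1)

/-- `ab` of a word is the corresponding monomial. [folklore] -/
theorem ab_single (u : FreeMonoid σ) (a : ℂ) :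
    ab (MonoidAlgebra.single u a) = monomial (Multiplicative.toAdd (abw u)) a := by
  rw [ab, ncEval_single]
  induction u using FreeMonoid.inductionOn' with
  | one => rw [map_one, map_one]; simp [MvPolynomial.smul_eq_C_mul]
  | mul_of x xs ih =>
    rw [map_mul, map_mul, FreeMonoid.lift_eval_of, abw, FreeMonoid.lift_eval_of, ← abw,
      ← mul_smul_comm, ih, toAdd_mul, toAdd_ofAdd,
      show (X x : MvPolynomial σ ℂ) = monomial (Finsupp.single x 1) 1 from rfl, monomial_mul, one_mul]

/-- Coefficients of `ab f`. [folklore] -/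
theorem coeff_ab [DecidableEq σ] (f : NC σ) (μ : σ →₀ ℕ) :
    coeff μ (ab f) = ∑ u ∈ f.coeff.support with Multiplicative.toAdd (abw u) = μ, f.coeff u := by
  classical
  conv_lhs => rw [← f.sum_coeff_single, Finsupp.sum, map_sum]
  rw [coeff_sum, Finset.sum_filter]
  refine Finset.sum_congr rfl fun u _ => ?_
  rw [ab_single, coeff_monomial]

/-- Coefficients of `ab f` on a larger finite set of words. [folklore] -/
theorem coeff_ab_of_subset [DecidableEq σ] (f : NC σ) (μ : σ →₀ ℕ) {U : Finset (FreeMonoid σ)}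
    (hU : f.coeff.support ⊆ U) :
    coeff μ (ab f) = ∑ u ∈ U with Multiplicative.toAdd (abw u) = μ, f.coeff u := by
  classical
  rw [coeff_ab, Finset.sum_filter, Finset.sum_filter]
  refine Finset.sum_subset hU fun u _ hu => ?_
  rw [Finsupp.notMem_support_iff.mp hu, ite_self]

/-- The matrix of a continuous linear map between Euclidean spaces in the standard bases.
[folklore] -/
theorem toEuclideanCLM_of_clm {ι : Type} [Fintype ι] [DecidableEq ι]
    (S : EuclideanSpace ℂ ι →L[ℂ] EuclideanSpace ℂ ι) :
    Matrix.toEuclideanCLM (𝕜 := ℂ) (Matrix.of fun k i => S (EuclideanSpace.single i 1) k) = S := by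
  apply ContinuousLinearMap.ext
  intro u
  apply PiLp.ext
  intro k
  rw [clm_apply_eq_sum S u k]
  show WithLp.ofLp (Matrix.toEuclideanCLM (𝕜 := ℂ) _ u) k = _
  rw [Matrix.ofLp_toEuclideanCLM]
  simp [Matrix.mulVec, dotProduct, mul_comm]

/-- A polynomial matrix vanishing at every point is zero. [folklore] -/
theorem matrix_eq_zero_of_eval {N : Type} [Fintype N] (M : Matrix N N (MvPolynomial σ ℂ))
    (h : ∀ z : σ → ℂ, M.map (eval z) = 0) : M = 0 := by
  refine Matrix.ext fun a b => ?_
  refine MvPolynomial.funext (R := ℂ) fun z => ?_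
  have := congrFun (congrFun (h z) a) b
  rw [Matrix.map_apply, Matrix.zero_apply] at this
  rw [this]
  exact (map_zero (eval z)).symm

/-- `det(I - M) = 1` for a nilpotent matrix over `ℂ[z]` vanishing at `z = 0`. [folklore] -/
theorem det_one_sub_eq_one_of_pow_eq_zero {N : Type} [Fintype N] [DecidableEq N]
    (M : Matrix N N (MvPolynomial σ ℂ)) {K : ℕ} (hM : M ^ K = 0)
    (h0 : M.map (eval (0 : σ → ℂ)) = 0) : (1 - M).det = 1 := by
  -- `(1 - M) (1 + M + ⋯ + M^{K-1}) = 1 - M^K = 1`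
  have hunit : IsUnit (1 - M).det := by
    have hgeom : (1 - M) * ∑ i ∈ Finset.range K, M ^ i = 1 := by
      rw [mul_neg_geom_sum M K, hM, sub_zero]
    have := congrArg Matrix.det hgeom
    rw [Matrix.det_mul, Matrix.det_one] at this
    exact IsUnit.of_mul_eq_one _ this
  obtain ⟨r, -, hr⟩ := MvPolynomial.isUnit_iff_eq_C_of_isReduced.1 hunit
  -- evaluate at `0`
  have h1 : eval (0 : σ → ℂ) (1 - M).det = 1 := by
    rw [RingHom.map_det, RingHom.mapMatrix_apply]
    have : (1 - M).map (eval (0 : σ → ℂ)) = 1 := by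
      rw [Matrix.map_sub _ (map_sub _), h0, sub_zero, Matrix.map_one _ (map_zero _) (map_one _)]
    rw [this, Matrix.det_one]
  rw [hr] at h1 ⊢
  rw [eval_C] at h1
  rw [h1, map_one]

/-- The square block `(S e_{inr n'})_{inl (inr n)}` of a continuous linear map
`S : ℂ^{A ⊕ N} → ℂ^{(A ⊕ N) ⊕ B}` has operator norm at most `‖S‖`. [folklore] -/
theorem norm_toEuclideanCLM_block_le {A B N : Type} [Fintype A] [Fintype B] [Fintype N]
    [DecidableEq A] [DecidableEq N]
    (S : EuclideanSpace ℂ (A ⊕ N) →L[ℂ] EuclideanSpace ℂ ((A ⊕ N) ⊕ B)) :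
    ‖Matrix.toEuclideanCLM (𝕜 := ℂ) (Matrix.of fun n n' : N =>
        S (EuclideanSpace.single (Sum.inr n') 1) (Sum.inl (Sum.inr n)))‖ ≤ ‖S‖ := by
  classical
  refine ContinuousLinearMap.opNorm_le_bound _ (norm_nonneg _) fun y => ?_
  set yt : EuclideanSpace ℂ (A ⊕ N) := WithLp.toLp 2 (Sum.elim 0 (WithLp.ofLp y)) with hyt
  have hyt_norm : ‖yt‖ = ‖y‖ := by
    have : ‖yt‖ ^ 2 = ‖y‖ ^ 2 := by
      simp only [PiLp.norm_sq_eq_of_L2, hyt, Fintype.sum_sum_type]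
      simp
    exact le_antisymm (le_of_pow_le_pow_left₀ two_ne_zero (norm_nonneg _) this.le)
      (le_of_pow_le_pow_left₀ two_ne_zero (norm_nonneg _) this.ge)
  have hentry : ∀ n, (Matrix.toEuclideanCLM (𝕜 := ℂ) (Matrix.of fun n n' : N =>
      S (EuclideanSpace.single (Sum.inr n') 1) (Sum.inl (Sum.inr n)))) y n =
        S yt (Sum.inl (Sum.inr n)) := by
    intro n
    show WithLp.ofLp (Matrix.toEuclideanCLM (𝕜 := ℂ) _ y) n = WithLp.ofLp (S yt) (Sum.inl (Sum.inr n))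
    rw [Matrix.ofLp_toEuclideanCLM, clm_apply_eq_sum S yt, Fintype.sum_sum_type]
    simp [Matrix.mulVec, dotProduct, hyt, mul_comm]
  have hsq_le : ‖(Matrix.toEuclideanCLM (𝕜 := ℂ) (Matrix.of fun n n' : N =>
      S (EuclideanSpace.single (Sum.inr n') 1) (Sum.inl (Sum.inr n)))) y‖ ^ 2 ≤ ‖S yt‖ ^ 2 := by
    rw [PiLp.norm_sq_eq_of_L2, PiLp.norm_sq_eq_of_L2]
    simp only [hentry]
    rw [Fintype.sum_sum_type, Fintype.sum_sum_type]
    have h1 : 0 ≤ ∑ a : A, ‖S yt (Sum.inl (Sum.inl a))‖ ^ 2 := Finset.sum_nonneg fun _ _ => by positivity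
    have h2 : 0 ≤ ∑ b : B, ‖S yt (Sum.inr b)‖ ^ 2 := Finset.sum_nonneg fun _ _ => by positivity
    linarith
  have h3 : ‖S yt‖ ≤ ‖S‖ * ‖y‖ := hyt_norm ▸ S.le_opNorm yt
  have h4 : ‖(Matrix.toEuclideanCLM (𝕜 := ℂ) (Matrix.of fun n n' : N =>
      S (EuclideanSpace.single (Sum.inr n') 1) (Sum.inl (Sum.inr n)))) y‖ ≤ ‖S yt‖ :=
    le_of_pow_le_pow_left₀ two_ne_zero (norm_nonneg _) hsq_le
  exact h4.trans h3

section W4lemma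
open _root_.Matrix
variable {S : Type*} [CommRing S] {m : Type*} [Fintype m] [DecidableEq m]

/-- **Rank-one downdate along a solved direction.** If `N x = u` then
`det (N - u rᵀ) = det N · (1 - r · x)` (no invertibility of `N` needed). [folklore] -/
theorem det_sub_replicateCol_mul_replicateRow_of_mulVec_eq (N : Matrix m m S) (u r x : m → S)
    (hx : N *ᵥ x = u) :
    (N - replicateCol Unit u * replicateRow Unit r).det = N.det * (1 - r ⬝ᵥ x) := by
  have h1 : (fromBlocks N (replicateCol Unit u) (replicateRow Unit r) (1 : Matrix Unit Unit S)).det =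
      (N - replicateCol Unit u * replicateRow Unit r).det := by
    rw [det_fromBlocks_one₂₂]
  have h2 : fromBlocks N (replicateCol Unit u) (replicateRow Unit r) (1 : Matrix Unit Unit S) *
      fromBlocks 1 (-replicateCol Unit x) 0 1 =
        fromBlocks N 0 (replicateRow Unit r) (1 - replicateRow Unit r * replicateCol Unit x) := by
    rw [fromBlocks_multiply]
    congr 1
    · simp
    · rw [Matrix.mul_neg, Matrix.mul_one, ← replicateCol_mulVec, hx, neg_add_cancel]
    · simp
    · rw [Matrix.mul_neg, Matrix.one_mul, sub_eq_neg_add]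
  have h3 : (fromBlocks (1 : Matrix m m S) (-replicateCol Unit x) 0 (1 : Matrix Unit Unit S)).det = 1 := by
    rw [det_fromBlocks_zero₂₁, det_one, det_one, one_mul]
  have h4 := congrArg det h2
  rw [det_mul, h3, mul_one, det_fromBlocks_zero₁₂, h1] at h4
  rw [h4]
  congr 1
  rw [det_unique, Matrix.sub_apply, one_apply_eq, replicateRow_mul_replicateCol_apply]

end W4lemma

/-! ### The free assembly: nilpotent inverse realization and the determinantal representation -/

section FreeAssembly

open _root_.Matrix

variable [Fintype σ] [DecidableEq σ]

/-- **Contractive determinantal representation from a free certificate.** Let `P̂ ∈ ℂ⟨g⟩` have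
constant term `1` and admit a free certificate `|P̂|² - c²·1 ∈ 𝒞_free` (`c > 0`). Then the
abelianisation `P = ab P̂` is `det(I - A Z)` for a contraction `A ∈ ℂ^{N×N}` and a colouring
`jj : N → σ` (`Z = diag(z_{jj(n)})`). Steps: free lurking contraction; the inverse state matrix
`A× = α - βγ/c` satisfies `A×P_{u₁}⋯A×P_{u_k} β = 0` for long words (comparison of WORD coefficients
— the step that fails commutatively); compressing by the orthogonal projection `Π` onto the
graded `A×`-cyclic subspace makes `A×Π Z` nilpotent while keeping the realization identities, so
`det(I - αΠ Z) = det(I - A×Π Z)·P = P`. [folklore] -/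
theorem ab_eq_det_of_certificate (Pn : NC σ) (hP1 : Pn.coeff 1 = 1) {c : ℝ} (hc : 0 < c)
    (hcert : hsqN Pn - (c ^ 2) • unitK σ ∈ coneN σ) :
    ∃ (N : Type) (_ : Fintype N) (_ : DecidableEq N) (A : Matrix N N ℂ) (jj : N → σ),
      ‖Matrix.toEuclideanCLM (𝕜 := ℂ) A‖ ≤ 1 ∧
        ab Pn = (1 - A.map (fun a : ℂ => (C a : MvPolynomial σ ℂ)) *
          Matrix.diagonal (fun n => X (jj n))).det := by
  classical
  have hcC : (c : ℂ) ≠ 0 := Complex.ofReal_ne_zero.mpr hc.ne'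
  -- Step 1: unpack the certificate and run the free lurking contraction
  obtain ⟨I₀, I₁, _, _, s, jj, t, hcert⟩ := exists_sum_hsqN_of_mem_coneN hcert
  let v : Unit ⊕ I₁ → NC σ := Sum.elim (fun _ => Pn) fun n => lmul (jj n) (t n)
  let x : (Unit ⊕ I₁) ⊕ I₀ → NC σ := Sum.elim (Sum.elim (fun _ => (c : ℂ) • (1 : NC σ)) t) s
  have hvx : ∑ i, hsqN (v i) = ∑ k, hsqN (x k) := by
    simp only [v, x, Fintype.sum_sum_type, Finset.univ_unique, Finset.sum_singleton,
      Sum.elim_inl, Sum.elim_inr]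
    have hcc : hsqN ((c : ℂ) • (1 : NC σ)) = (c ^ 2) • unitK σ := by
      rw [hsqN_smul, MonoidAlgebra.one_def, hsqN_single_one, Complex.normSq_ofReal, ofReal_smulK,
        pow_two]
    rw [hcc]
    have := hcert
    simp only [hsqN_lmul, Finset.sum_sub_distrib] at this
    rw [sub_eq_iff_eq_add] at this
    rw [this]
    simp only [hsqN_lmul]
    abel
  obtain ⟨S, hSnorm, hS⟩ := lurking_contractionN v x hvx
  -- the blocks
  set d : ℂ := S (EuclideanSpace.single (Sum.inl ()) 1) (Sum.inl (Sum.inl ())) with hd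
  set γ : I₁ → ℂ := fun i => S (EuclideanSpace.single (Sum.inr i) 1) (Sum.inl (Sum.inl ())) with hγ
  set β : I₁ → ℂ := fun n => S (EuclideanSpace.single (Sum.inl ()) 1) (Sum.inl (Sum.inr n)) with hβ
  set α : Matrix I₁ I₁ ℂ := Matrix.of fun n n' =>
    S (EuclideanSpace.single (Sum.inr n') 1) (Sum.inl (Sum.inr n)) with hα
  have hαnorm : ‖Matrix.toEuclideanCLM (𝕜 := ℂ) α‖ ≤ 1 :=
    (norm_toEuclideanCLM_block_le S).trans hSnorm
  -- the free realization identities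
  have eq1 : (c : ℂ) • (1 : NC σ) = d • Pn + ∑ i, γ i • lmul (jj i) (t i) := by
    have := hS (Sum.inl (Sum.inl ()))
    simpa [x, v, Fintype.sum_sum_type] using this
  have eq2 : ∀ n, t n = β n • Pn + ∑ i, α n i • lmul (jj i) (t i) := by
    intro n
    have := hS (Sum.inl (Sum.inr n))
    simpa [x, v, Fintype.sum_sum_type, hα] using this
  -- Step 2: `d = c` (constant terms)
  have hlmul1 : ∀ (j : σ) (f : NC σ), (lmul j f).coeff 1 = 0 := fun j f =>
    coeff_lmul_of_ne j f 1 fun u => FreeMonoid_of_mul_ne_one j u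
  have hdc : d = c := by
    have := congrArg (fun f : NC σ => f.coeff 1) eq1
    simp only [MonoidAlgebra.coeff_smul_apply, MonoidAlgebra.coeff_add, Finsupp.add_apply,
      MonoidAlgebra.coeff_sum, Finsupp.coe_finsetSum, Finset.sum_apply, hlmul1, smul_eq_mul,
      mul_zero, Finset.sum_const_zero, add_zero, hP1, mul_one, MonoidAlgebra.one_def,
      MonoidAlgebra.coeff_single, Finsupp.single_eq_same] at this
    exact this.symm
  rw [hdc] at eq1
  -- Step 3: the inverse realization identity `t n = β n · 1 + Σ_i A×_{ni} g_{jj i} t i`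
  set Ax : Matrix I₁ I₁ ℂ := Matrix.of fun n i => α n i - β n * γ i / c with hAx
  have eq3 : ∀ n, t n = β n • (1 : NC σ) + ∑ i, Ax n i • lmul (jj i) (t i) := by
    intro n
    have hPn : Pn = 1 - (c : ℂ)⁻¹ • ∑ i, γ i • lmul (jj i) (t i) := by
      have : (c : ℂ)⁻¹ • ((c : ℂ) • (1 : NC σ)) = (c : ℂ)⁻¹ • ((c : ℂ) • Pn + ∑ i, γ i • lmul (jj i) (t i)) := by
        rw [eq1]
      rw [smul_smul, smul_add, smul_smul, inv_mul_cancel₀ hcC, one_smul, one_smul] at this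
      rw [this]; abel
    conv_lhs => rw [eq2 n, hPn]
    rw [smul_sub, smul_smul, Finset.smul_sum, hAx]
    simp only [Matrix.of_apply, sub_smul, Finset.sum_sub_distrib, smul_smul]
    have : ∀ i, β n * γ i / (c : ℂ) = β n * (c : ℂ)⁻¹ * γ i := fun i => by ring
    simp only [this]
    abel
  -- Step 4: word-coefficient vectors `V u = ((t n)_u)_n`: `V 1 = β`, `V (g_j u) = A× P_j V u`
  let Vv : FreeMonoid σ → EuclideanSpace ℂ I₁ := fun u => WithLp.toLp 2 fun n => (t n).coeff u
  let Pm : σ → Matrix I₁ I₁ ℂ := fun j => Matrix.diagonal fun n => if jj n = j then (1 : ℂ) else 0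
  let Pe : σ → EuclideanSpace ℂ I₁ →L[ℂ] EuclideanSpace ℂ I₁ := fun j =>
    Matrix.toEuclideanCLM (𝕜 := ℂ) (Pm j)
  let AxE : EuclideanSpace ℂ I₁ →L[ℂ] EuclideanSpace ℂ I₁ := Matrix.toEuclideanCLM (𝕜 := ℂ) Ax
  have hPe_apply : ∀ (j : σ) (y : EuclideanSpace ℂ I₁) (n : I₁),
      Pe j y n = (if jj n = j then (1 : ℂ) else 0) * y n := by
    intro j y n
    show WithLp.ofLp (Matrix.toEuclideanCLM (𝕜 := ℂ) (Pm j) y) n = _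
    rw [Matrix.ofLp_toEuclideanCLM, Matrix.mulVec_diagonal]
  have hAxE_apply : ∀ (y : EuclideanSpace ℂ I₁) (n : I₁), AxE y n = ∑ i, Ax n i * y i := by
    intro y n
    show WithLp.ofLp (Matrix.toEuclideanCLM (𝕜 := ℂ) Ax y) n = _
    rw [Matrix.ofLp_toEuclideanCLM]; rfl
  have hV1 : Vv 1 = WithLp.toLp 2 β := by
    apply PiLp.ext; intro n
    show (t n).coeff 1 = β n
    rw [eq3 n]
    simp only [MonoidAlgebra.coeff_add, MonoidAlgebra.coeff_smul_apply, Finsupp.add_apply,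
      MonoidAlgebra.coeff_sum, Finsupp.coe_finsetSum, Finset.sum_apply, hlmul1, smul_eq_mul,
      mul_zero, Finset.sum_const_zero, add_zero, MonoidAlgebra.one_def, MonoidAlgebra.coeff_single,
      Finsupp.single_eq_same, mul_one]
  have hVcons : ∀ (j : σ) (u : FreeMonoid σ), Vv (FreeMonoid.of j * u) = AxE (Pe j (Vv u)) := by
    intro j u
    apply PiLp.ext; intro n
    rw [hAxE_apply]
    show (t n).coeff (FreeMonoid.of j * u) = _
    rw [eq3 n]
    simp only [MonoidAlgebra.coeff_add, MonoidAlgebra.coeff_smul_apply, Finsupp.add_apply,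
      MonoidAlgebra.coeff_sum, Finsupp.coe_finsetSum, Finset.sum_apply, smul_eq_mul,
      MonoidAlgebra.one_def, MonoidAlgebra.coeff_single, Finsupp.single_apply,
      (FreeMonoid_of_mul_ne_one j u).symm, if_false, mul_zero, zero_add]
    refine Finset.sum_congr rfl fun i _ => ?_
    rw [hPe_apply]
    congr 1
    by_cases hij : jj i = j
    · rw [if_pos hij, one_mul, ← hij, coeff_lmul_cons]
    · rw [if_neg hij, zero_mul, coeff_lmul_of_ne]
      intro u' h'
      exact hij (FreeMonoid_of_mul_eq_of_mul_iff.mp h').1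
  -- vanishing of long words
  obtain ⟨K₀, hK₀⟩ : ∃ K₀ : ℕ, ∀ n, ∀ u ∈ (t n).coeff.support, u.length ≤ K₀ :=
    ⟨Finset.univ.sup fun n => (t n).coeff.support.sup FreeMonoid.length, fun n u hu =>
      (Finset.le_sup (f := FreeMonoid.length) hu).trans
        (Finset.le_sup (f := fun n => (t n).coeff.support.sup FreeMonoid.length) (Finset.mem_univ n))⟩
  have hVlong : ∀ u : FreeMonoid σ, K₀ < u.length → Vv u = 0 := by
    intro u hu
    apply PiLp.ext; intro n
    show (t n).coeff u = 0
    by_contra hne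
    exact absurd (hK₀ n u (Finsupp.mem_support_iff.mpr hne)) (not_le.mpr hu)
  -- Step 5: the graded cyclic subspaces `W_k = span {P_i V u : |u| ≥ k}`
  let Wk : ℕ → Submodule ℂ (EuclideanSpace ℂ I₁) := fun k =>
    Submodule.span ℂ {w | ∃ (i : σ) (u : FreeMonoid σ), k ≤ u.length ∧ w = Pe i (Vv u)}
  have hWk_anti : ∀ {k l : ℕ}, k ≤ l → Wk l ≤ Wk k := by
    intro k l hkl
    refine Submodule.span_mono ?_
    rintro w ⟨i, u, hu, rfl⟩
    exact ⟨i, u, hkl.trans hu, rfl⟩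
  have hPePe : ∀ (i j : σ) (y : EuclideanSpace ℂ I₁),
      Pe j (Pe i y) = if i = j then Pe i y else 0 := by
    intro i j y
    apply PiLp.ext; intro n
    rw [hPe_apply, hPe_apply]
    by_cases hij : i = j
    · subst hij
      rw [if_pos rfl, hPe_apply]
      by_cases h1 : jj n = i
      · rw [if_pos h1, one_mul, one_mul]
      · rw [if_neg h1, zero_mul, zero_mul]
    · rw [if_neg hij, WithLp.ofLp_zero, Pi.zero_apply]
      by_cases h1 : jj n = j
      · rw [if_pos h1, one_mul, if_neg (fun h => hij (h.symm.trans h1)), zero_mul]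
      · rw [if_neg h1, zero_mul]
  have hsumPe : ∀ y : EuclideanSpace ℂ I₁, ∑ i, Pe i y = y := by
    intro y
    apply PiLp.ext; intro n
    rw [WithLp.ofLp_sum, Finset.sum_apply]
    simp only [hPe_apply, ite_mul, one_mul, zero_mul]
    rw [Finset.sum_ite_eq, if_pos (Finset.mem_univ _)]
  have hVmem : ∀ (u : FreeMonoid σ), Vv u ∈ Wk u.length := by
    intro u
    rw [← hsumPe (Vv u)]
    exact Submodule.sum_mem _ fun i _ => Submodule.subset_span ⟨i, u, le_rfl, rfl⟩
  have hstep : ∀ (k : ℕ) (j : σ), ∀ w ∈ Wk k, AxE (Pe j w) ∈ Wk (k + 1) := by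
    intro k j w hw
    induction hw using Submodule.span_induction with
    | mem w hw =>
      obtain ⟨i, u, hu, rfl⟩ := hw
      rw [hPePe]
      split_ifs with hij
      · subst hij
        rw [← hVcons]
        have := hVmem (FreeMonoid.of i * u)
        rw [FreeMonoid.length_mul, FreeMonoid.length_of] at this
        exact hWk_anti (by omega) this
      · rw [map_zero]; exact Submodule.zero_mem _
    | zero => rw [map_zero, map_zero]; exact Submodule.zero_mem _
    | add w w' _ _ hw hw' => rw [map_add, map_add]; exact Submodule.add_mem _ hw hw'
    | smul a w _ hw => rw [map_smul, map_smul]; exact Submodule.smul_mem _ _ hw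
  have hWk_top : Wk (K₀ + 1) = ⊥ := by
    rw [Submodule.span_eq_bot]
    rintro w ⟨i, u, hu, rfl⟩
    rw [hVlong u (by omega), map_zero]
  have hPeW : ∀ (k : ℕ) (j : σ), ∀ w ∈ Wk k, Pe j w ∈ Wk k := by
    intro k j w hw
    induction hw using Submodule.span_induction with
    | mem w hw =>
      obtain ⟨i, u, hu, rfl⟩ := hw
      rw [hPePe]
      split_ifs
      · exact Submodule.subset_span ⟨i, u, hu, rfl⟩
      · exact Submodule.zero_mem _
    | zero => rw [map_zero]; exact Submodule.zero_mem _
    | add w w' _ _ hw hw' => rw [map_add]; exact Submodule.add_mem _ hw hw'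
    | smul a w _ hw => rw [map_smul]; exact Submodule.smul_mem _ _ hw
  -- `A× Z(z)` as an operator and its nilpotency on `W = W_0`
  let AZ : (σ → ℂ) → EuclideanSpace ℂ I₁ →L[ℂ] EuclideanSpace ℂ I₁ := fun z =>
    ∑ j, z j • (AxE.comp (Pe j))
  have hAZ_mem : ∀ (z : σ → ℂ) (k : ℕ), ∀ w ∈ Wk k, AZ z w ∈ Wk (k + 1) := by
    intro z k w hw
    show (∑ j, z j • (AxE.comp (Pe j))) w ∈ Wk (k + 1)
    rw [_root_.sum_apply]
    refine Submodule.sum_mem _ fun j _ => ?_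
    exact Submodule.smul_mem _ _ (hstep k j w hw)
  have hAZ_pow : ∀ (z : σ → ℂ) (m k : ℕ), ∀ w ∈ Wk k, ((AZ z) ^ m) w ∈ Wk (k + m) := by
    intro z m
    induction m with
    | zero => intro k w hw; simpa using hw
    | succ m ih =>
      intro k w hw
      rw [pow_succ]
      show ((AZ z) ^ m) (AZ z w) ∈ Wk (k + (m + 1))
      have := ih (k + 1) _ (hAZ_mem z k w hw)
      rwa [show k + 1 + m = k + (m + 1) by omega] at this
  have hAZ_nil : ∀ (z : σ → ℂ), ∀ w ∈ Wk 0, ((AZ z) ^ (K₀ + 1)) w = 0 := by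
    intro z w hw
    have := hAZ_pow z (K₀ + 1) 0 w hw
    rw [zero_add, hWk_top, Submodule.mem_bot] at this
    exact this
  -- Step 6: the orthogonal projection `Pr` onto `W = W_0` and its matrix
  set W : Submodule ℂ (EuclideanSpace ℂ I₁) := Wk 0 with hWdef
  haveI : W.HasOrthogonalProjection := inferInstance
  set Pr : EuclideanSpace ℂ I₁ →L[ℂ] EuclideanSpace ℂ I₁ := W.starProjection with hPrdef
  have hPrfix : ∀ w ∈ W, Pr w = w := fun w hw => Submodule.starProjection_eq_self_iff.mpr hw
  have hPrmem : ∀ y, Pr y ∈ W := fun y => Submodule.starProjection_apply_mem W y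
  have hPrnorm : ‖Pr‖ ≤ 1 := Submodule.starProjection_norm_le W
  -- `Pe j` is self-adjoint, so `W^⊥` is `Pe j`-invariant and `Pr` commutes with `Pe j`
  have hPe_inner : ∀ (j : σ) (y y' : EuclideanSpace ℂ I₁),
      inner ℂ (Pe j y) y' = inner ℂ y (Pe j y') := by
    intro j y y'
    rw [PiLp.inner_apply, PiLp.inner_apply]
    refine Finset.sum_congr rfl fun n _ => ?_
    rw [hPe_apply, hPe_apply, RCLike.inner_apply, RCLike.inner_apply, map_mul]
    split_ifs <;> simp
  have hPrPe : ∀ (j : σ) (y : EuclideanSpace ℂ I₁), Pr (Pe j y) = Pe j (Pr y) := by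
    intro j y
    have hdec : y = Pr y + (y - Pr y) := by abel
    have hperp : y - Pr y ∈ Wᗮ := Submodule.sub_starProjection_mem_orthogonal y
    have hperp' : Pe j (y - Pr y) ∈ Wᗮ := by
      rw [Submodule.mem_orthogonal] at hperp ⊢
      intro w hw
      rw [← hPe_inner, hperp _ (hPeW 0 j w hw)]  -- uses symmetry form ⟪w, Pe (y-Pry)⟫
    conv_lhs => rw [hdec, map_add, map_add]
    rw [hPrfix _ (hPeW 0 j _ (hPrmem y)), (Submodule.starProjection_apply_eq_zero_iff W).mpr hperp',
      add_zero]
  set Prm : Matrix I₁ I₁ ℂ := Matrix.of fun a b => Pr (EuclideanSpace.single b 1) a with hPrm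
  have hPrm_clm : Matrix.toEuclideanCLM (𝕜 := ℂ) Prm = Pr := toEuclideanCLM_of_clm Pr
  have hPrm_block : ∀ a b : I₁, jj a ≠ jj b → Prm a b = 0 := by
    intro a b hab
    have h1 : Pe (jj b) (EuclideanSpace.single b (1 : ℂ)) = EuclideanSpace.single b 1 := by
      apply PiLp.ext; intro n
      rw [hPe_apply]
      by_cases hn : n = b
      · subst hn; simp
      · simp [hn]
    have h2 := hPrPe (jj b) (EuclideanSpace.single b 1)
    rw [h1] at h2
    have h3 := congrArg (fun y : EuclideanSpace ℂ I₁ => y a) h2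
    simp only at h3
    rw [hPe_apply, if_neg hab, zero_mul] at h3
    rw [hPrm, Matrix.of_apply]
    exact h3
  -- matrix consequences
  have hPrm_mulVec_mem : ∀ (y : I₁ → ℂ), WithLp.toLp 2 y ∈ W → Prm *ᵥ y = y := by
    intro y hy
    have := hPrfix _ hy
    rw [← hPrm_clm] at this
    have h := congrArg WithLp.ofLp this
    rw [Matrix.ofLp_toEuclideanCLM] at h
    exact h
  -- Step 7: the compressed colligation
  set α' : Matrix I₁ I₁ ℂ := α * Prm with hα'
  set γ' : I₁ → ℂ := γ ᵥ* Prm with hγ'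
  have hα'norm : ‖Matrix.toEuclideanCLM (𝕜 := ℂ) α'‖ ≤ 1 := by
    rw [hα', map_mul, hPrm_clm]
    refine (ContinuousLinearMap.opNorm_comp_le _ _).trans ?_
    calc ‖Matrix.toEuclideanCLM (𝕜 := ℂ) α‖ * ‖Pr‖ ≤ 1 * 1 :=
        mul_le_mul hαnorm hPrnorm (norm_nonneg _) zero_le_one
      _ = 1 := mul_one 1
  -- the commutative data
  set P : MvPolynomial σ ℂ := ab Pn with hPdef
  set G : I₁ → MvPolynomial σ ℂ := fun n => ab (t n) with hG
  set Zd : Matrix I₁ I₁ (MvPolynomial σ ℂ) := Matrix.diagonal fun n => X (jj n) with hZd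
  have hZG : Zd *ᵥ G = fun i => X (jj i) * G i := by
    ext i; rw [hZd, Matrix.mulVec_diagonal]
  -- coefficient vectors of `G` lie in `W`
  set U : Finset (FreeMonoid σ) := Finset.univ.biUnion fun n => (t n).coeff.support with hU
  have hUsub : ∀ n, (t n).coeff.support ⊆ U := fun n =>
    Finset.subset_biUnion_of_mem (fun n => (t n).coeff.support) (Finset.mem_univ n)
  have hGcoeff_mem : ∀ μ : σ →₀ ℕ, WithLp.toLp 2 (fun n => coeff μ (G n)) ∈ W := by
    intro μ
    have : (WithLp.toLp 2 (fun n => coeff μ (G n)) : EuclideanSpace ℂ I₁) =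
        ∑ u ∈ U with Multiplicative.toAdd (abw u) = μ, Vv u := by
      apply PiLp.ext; intro n
      rw [WithLp.ofLp_sum, Finset.sum_apply]
      show coeff μ (ab (t n)) = _
      rw [coeff_ab_of_subset (t n) μ (hUsub n)]
    rw [this]
    exact Submodule.sum_mem _ fun u _ => hWk_anti (Nat.zero_le _) (hVmem u)
  have hPrG : Prm.map (fun a : ℂ => (C a : MvPolynomial σ ℂ)) *ᵥ G = G := by
    funext n
    apply MvPolynomial.ext
    intro μ
    rw [Matrix.mulVec, dotProduct, coeff_sum]
    simp only [Matrix.map_apply, coeff_C_mul]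
    have := congrFun (hPrm_mulVec_mem (fun n => coeff μ (G n)) (hGcoeff_mem μ)) n
    rw [Matrix.mulVec, dotProduct] at this
    exact this
  have hPrZ : Prm.map (fun a : ℂ => (C a : MvPolynomial σ ℂ)) * Zd =
      Zd * Prm.map (fun a : ℂ => (C a : MvPolynomial σ ℂ)) := by
    refine Matrix.ext fun a b => ?_
    rw [hZd, Matrix.mul_diagonal, Matrix.diagonal_mul, Matrix.map_apply]
    by_cases hab : jj a = jj b
    · rw [hab, mul_comm]
    · rw [hPrm_block a b hab, map_zero, mul_zero, zero_mul]
  have hPrZG : Prm.map (fun a : ℂ => (C a : MvPolynomial σ ℂ)) *ᵥ (Zd *ᵥ G) = Zd *ᵥ G := by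
    rw [Matrix.mulVec_mulVec, hPrZ, ← Matrix.mulVec_mulVec, hPrG]
  -- abelianised identities
  have eq1c : (C (c : ℂ) : MvPolynomial σ ℂ) = C (c : ℂ) * P +
      ∑ i, C (γ i) * (X (jj i) * G i) := by
    have := congrArg ab eq1
    rw [map_smul, map_add, map_smul, map_sum, ab_one] at this
    simp only [map_smul, ab_lmul, MvPolynomial.smul_eq_C_mul, mul_one] at this
    exact this
  have eq2c : ∀ n, G n = C (β n) * P + ∑ i, C (α n i) * (X (jj i) * G i) := by
    intro n
    have := congrArg ab (eq2 n)
    rw [map_add, map_smul, map_sum] at this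
    simp only [map_smul, ab_lmul, MvPolynomial.smul_eq_C_mul] at this
    exact this
  -- in matrix form with the compressed blocks
  have eq2m : G = (fun n => C (β n) * P) +
      α'.map (fun a : ℂ => (C a : MvPolynomial σ ℂ)) *ᵥ (Zd *ᵥ G) := by
    have hαm : α'.map (fun a : ℂ => (C a : MvPolynomial σ ℂ)) *ᵥ (Zd *ᵥ G) =
        α.map (fun a : ℂ => (C a : MvPolynomial σ ℂ)) *ᵥ (Zd *ᵥ G) := by
      rw [hα', Matrix.map_mul, ← Matrix.mulVec_mulVec, hPrZG]
    rw [hαm, hZG]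
    funext n
    rw [Pi.add_apply, eq2c n]
    simp only [Matrix.mulVec, dotProduct, Matrix.map_apply]
  have eq1m : (fun i => C (γ' i)) ⬝ᵥ (Zd *ᵥ G) = C (c : ℂ) - C (c : ℂ) * P := by
    have h1 : (fun i => C (γ' i)) = (fun i => C (γ i)) ᵥ* Prm.map (fun a : ℂ => (C a : MvPolynomial σ ℂ)) := by
      rw [hγ']
      funext i
      simp only [Matrix.vecMul, dotProduct, Matrix.map_apply, map_sum, map_mul]
    rw [h1, ← Matrix.dotProduct_mulVec, hPrZG, hZG]
    simp only [dotProduct]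
    linear_combination (-1 : MvPolynomial σ ℂ) * eq1c
  -- Step 8: the inverse pencil `𝒩 = 1 - A'× Z` and the solved direction `𝒩 G = β`
  set Ax' : Matrix I₁ I₁ ℂ := Matrix.of fun n i => α' n i - β n * γ' i / c with hAx'
  set 𝒩 : Matrix I₁ I₁ (MvPolynomial σ ℂ) :=
    1 - Ax'.map (fun a : ℂ => (C a : MvPolynomial σ ℂ)) * Zd with h𝒩
  have hsplit : ∀ (n : I₁) (y : I₁ → MvPolynomial σ ℂ),
      ∑ i, C (α' n i - β n * γ' i / c) * y i =
        (α'.map (fun a : ℂ => (C a : MvPolynomial σ ℂ)) *ᵥ y) n -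
          C (β n / c) * ((fun i => C (γ' i)) ⬝ᵥ y) := by
    intro n y
    have hre : ∀ i, α' n i - β n * γ' i / (c : ℂ) = α' n i - β n / c * γ' i := fun i => by ring
    simp only [Matrix.mulVec, dotProduct, Matrix.map_apply, Finset.mul_sum, ← Finset.sum_sub_distrib]
    refine Finset.sum_congr rfl fun i _ => ?_
    rw [hre, map_sub, map_mul]; ring
  have e2 : ∀ n, (α'.map (fun a : ℂ => (C a : MvPolynomial σ ℂ)) *ᵥ (Zd *ᵥ G)) n =
      G n - C (β n) * P := by
    intro n
    have := congrFun eq2m n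
    simp only [Pi.add_apply] at this
    linear_combination (-1 : MvPolynomial σ ℂ) * this
  have hβc : ∀ n, C (β n / (c : ℂ)) * C (c : ℂ) = (C (β n) : MvPolynomial σ ℂ) := fun n => by
    rw [← map_mul, div_mul_cancel₀ _ hcC]
  have hNG : 𝒩 *ᵥ G = fun n => C (β n) := by
    funext n
    rw [h𝒩, Matrix.sub_mulVec, Matrix.one_mulVec, ← Matrix.mulVec_mulVec]
    simp only [Pi.sub_apply]
    rw [Matrix.mulVec, dotProduct]
    simp only [Matrix.map_apply, hAx', Matrix.of_apply]
    rw [hsplit n (Zd *ᵥ G), e2, eq1m]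
    linear_combination (1 - P) * hβc n
  have hx : 𝒩 *ᵥ (fun n => C ((c : ℂ)⁻¹) * G n) = fun n => C (β n / c) := by
    have : (fun n => C ((c : ℂ)⁻¹) * G n) = (C ((c : ℂ)⁻¹) : MvPolynomial σ ℂ) • G := by
      funext n; rfl
    rw [this, Matrix.mulVec_smul, hNG]
    funext n
    simp only [Pi.smul_apply, smul_eq_mul, ← map_mul]
    congr 1
    field_simp
  have hdet := det_sub_replicateCol_mul_replicateRow_of_mulVec_eq 𝒩
    (fun n => C (β n / c)) (fun i => C (γ' i) * X (jj i)) (fun n => C ((c : ℂ)⁻¹) * G n) hx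
  have hlhs : 𝒩 - Matrix.replicateCol Unit (fun n => C (β n / (c : ℂ))) *
      Matrix.replicateRow Unit (fun i => C (γ' i) * X (jj i)) =
        1 - α'.map (fun a : ℂ => (C a : MvPolynomial σ ℂ)) * Zd := by
    refine Matrix.ext fun n i => ?_
    rw [h𝒩, hZd, hAx', Matrix.sub_apply, Matrix.sub_apply, Matrix.sub_apply, Matrix.mul_diagonal,
      Matrix.mul_diagonal, Matrix.map_apply, Matrix.map_apply, Matrix.of_apply, Matrix.mul_apply]
    simp only [Finset.univ_unique, Finset.sum_singleton, Matrix.replicateCol_apply,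
      Matrix.replicateRow_apply]
    have : α' n i - β n * γ' i / (c : ℂ) = α' n i - β n / c * γ' i := by ring
    rw [this, map_sub, map_mul]
    ring
  have hrhs : 1 - (fun i => C (γ' i) * X (jj i)) ⬝ᵥ (fun n => C ((c : ℂ)⁻¹) * G n) = P := by
    have h1 : (fun i => C (γ' i) * X (jj i)) ⬝ᵥ (fun n => C ((c : ℂ)⁻¹) * G n) =
        C ((c : ℂ)⁻¹) * ((fun i => C (γ' i)) ⬝ᵥ (Zd *ᵥ G)) := by
      rw [hZG]
      simp only [dotProduct, Finset.mul_sum]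
      exact Finset.sum_congr rfl fun i _ => by ring
    rw [h1, eq1m, mul_sub, ← mul_assoc, ← map_mul, inv_mul_cancel₀ hcC, map_one, one_mul]
    ring
  have hdet' : (1 - α'.map (fun a : ℂ => (C a : MvPolynomial σ ℂ)) * Zd).det = 𝒩.det * P := by
    rw [← hlhs, hdet, hrhs]
  -- Step 9: `A'× = A× Π` and nilpotency of `A'× Z`
  have hAx'_eq : Ax' = Ax * Prm := by
    refine Matrix.ext fun n i => ?_
    rw [hAx', Matrix.of_apply, hα', hγ', Matrix.mul_apply, Matrix.mul_apply, hAx]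
    simp only [Matrix.of_apply, Matrix.vecMul, dotProduct, Finset.mul_sum, Finset.sum_div,
      ← Finset.sum_sub_distrib]
    refine Finset.sum_congr rfl fun b _ => ?_
    ring
  -- pointwise (complex) facts
  have hPrm_block' : ∀ (z : σ → ℂ), Prm * Matrix.diagonal (fun n => z (jj n)) =
      Matrix.diagonal (fun n => z (jj n)) * Prm := by
    intro z
    refine Matrix.ext fun a b => ?_
    rw [Matrix.mul_diagonal, Matrix.diagonal_mul]
    by_cases hab : jj a = jj b
    · rw [hab, mul_comm]
    · rw [hPrm_block a b hab, mul_zero, zero_mul]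
  have hAxW : ∀ w ∈ W, AxE w ∈ W := by
    intro w hw
    rw [← hsumPe w, map_sum]
    exact Submodule.sum_mem _ fun j _ => hWk_anti (Nat.zero_le _) (hstep 0 j w hw)
  have hPrAxPr : Prm * Ax * Prm = Ax * Prm := by
    suffices h : Matrix.toEuclideanCLM (n := I₁) (𝕜 := ℂ) (Prm * Ax * Prm) =
        Matrix.toEuclideanCLM (n := I₁) (𝕜 := ℂ) (Ax * Prm) from
      (Matrix.toEuclideanCLM (n := I₁) (𝕜 := ℂ)).injective h
    rw [map_mul, map_mul, map_mul, hPrm_clm]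
    apply ContinuousLinearMap.ext
    intro y
    show Pr (AxE (Pr y)) = AxE (Pr y)
    exact hPrfix _ (hAxW _ (hPrmem y))
  have hAZ_apply : ∀ (z : σ → ℂ) (y : EuclideanSpace ℂ I₁), AZ z y = ∑ j, z j • AxE (Pe j y) := by
    intro z y
    show (∑ j, z j • (AxE.comp (Pe j))) y = _
    simp
  have hAxDz : ∀ z : σ → ℂ, Matrix.toEuclideanCLM (𝕜 := ℂ) (Ax * Matrix.diagonal fun n => z (jj n)) =
      AZ z := by
    intro z
    apply ContinuousLinearMap.ext
    intro y
    apply PiLp.ext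
    intro n
    rw [hAZ_apply]
    show WithLp.ofLp (Matrix.toEuclideanCLM (𝕜 := ℂ) _ y) n = _
    rw [Matrix.ofLp_toEuclideanCLM, ← Matrix.mulVec_mulVec, Matrix.mulVec, dotProduct,
      WithLp.ofLp_sum, Finset.sum_apply]
    simp only [Matrix.mulVec_diagonal, WithLp.ofLp_smul, Pi.smul_apply, smul_eq_mul, hAxE_apply,
      hPe_apply, Finset.mul_sum]
    rw [Finset.sum_comm]
    refine Finset.sum_congr rfl fun i _ => ?_
    simp only [mul_ite, mul_zero, ite_mul, zero_mul]
    rw [Finset.sum_ite_eq, if_pos (Finset.mem_univ _)]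
    ring
  have hnilz : ∀ z : σ → ℂ,
      (Ax * Matrix.diagonal (fun n => z (jj n))) ^ (K₀ + 1) * Prm = 0 := by
    intro z
    suffices h : Matrix.toEuclideanCLM (n := I₁) (𝕜 := ℂ)
        ((Ax * Matrix.diagonal (fun n => z (jj n))) ^ (K₀ + 1) * Prm) =
        Matrix.toEuclideanCLM (n := I₁) (𝕜 := ℂ) 0 from
      (Matrix.toEuclideanCLM (n := I₁) (𝕜 := ℂ)).injective h
    rw [map_mul, map_pow, hAxDz, hPrm_clm, map_zero]
    apply ContinuousLinearMap.ext
    intro y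
    show ((AZ z) ^ (K₀ + 1)) (Pr y) = 0
    exact hAZ_nil z _ (hPrmem y)
  have hpowz : ∀ (z : σ → ℂ) (k : ℕ),
      (Ax * Prm * Matrix.diagonal (fun n => z (jj n))) ^ (k + 1) =
        (Ax * Matrix.diagonal (fun n => z (jj n))) ^ (k + 1) * Prm := by
    intro z k
    induction k with
    | zero =>
      rw [zero_add, pow_one, pow_one, Matrix.mul_assoc, hPrm_block', ← Matrix.mul_assoc]
    | succ k ih =>
      rw [pow_succ, ih, pow_succ _ (k + 1)]
      calc (Ax * Matrix.diagonal (fun n => z (jj n))) ^ (k + 1) * Prm *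
            (Ax * Prm * Matrix.diagonal fun n => z (jj n))
          = (Ax * Matrix.diagonal (fun n => z (jj n))) ^ (k + 1) * (Prm * Ax * Prm) *
              Matrix.diagonal (fun n => z (jj n)) := by
            simp only [Matrix.mul_assoc]
        _ = (Ax * Matrix.diagonal (fun n => z (jj n))) ^ (k + 1) * (Ax * Prm) *
              Matrix.diagonal (fun n => z (jj n)) := by rw [hPrAxPr]
        _ = (Ax * Matrix.diagonal (fun n => z (jj n))) ^ (k + 1) *
              (Ax * Matrix.diagonal (fun n => z (jj n))) * Prm := by
            rw [Matrix.mul_assoc, Matrix.mul_assoc, hPrm_block', ← Matrix.mul_assoc,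
              ← Matrix.mul_assoc, ← Matrix.mul_assoc]
  have hnil : (Ax'.map (fun a : ℂ => (C a : MvPolynomial σ ℂ)) * Zd) ^ (K₀ + 1) = 0 := by
    refine matrix_eq_zero_of_eval _ fun z => ?_
    have hmap : ((Ax'.map (fun a : ℂ => (C a : MvPolynomial σ ℂ)) * Zd) ^ (K₀ + 1)).map (eval z) =
        (Ax * Prm * Matrix.diagonal (fun n => z (jj n))) ^ (K₀ + 1) := by
      have hAxC : (Ax'.map (fun a : ℂ => (C a : MvPolynomial σ ℂ))).map (eval z) = Ax' := by
        rw [Matrix.map_map]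
        refine Matrix.ext fun a b => ?_
        rw [Matrix.map_apply, Function.comp_apply, eval_C]
      have hZdz : Zd.map (eval z) = Matrix.diagonal fun n => z (jj n) := by
        rw [hZd, Matrix.diagonal_map (map_zero _)]
        congr 1
        funext n
        exact eval_X _
      rw [← RingHom.mapMatrix_apply, map_pow, RingHom.mapMatrix_apply, Matrix.map_mul, hAxC, hZdz,
        hAx'_eq]
    rw [hmap, hpowz, hnilz]
  have h0 : (Ax'.map (fun a : ℂ => (C a : MvPolynomial σ ℂ)) * Zd).map (eval (0 : σ → ℂ)) = 0 := by
    rw [Matrix.map_mul, hZd, Matrix.diagonal_map (map_zero _)]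
    have : (fun n => eval (0 : σ → ℂ) (X (jj n))) = fun _ => 0 := by
      funext n; rw [eval_X]; rfl
    rw [show (Matrix.diagonal fun m => (eval (0 : σ → ℂ)) (X (jj m))) = 0 by
      rw [this]; exact Matrix.diagonal_zero, Matrix.mul_zero]
  have hdet𝒩 : 𝒩.det = 1 := det_one_sub_eq_one_of_pow_eq_zero _ hnil h0
  exact ⟨I₁, inferInstance, inferInstance, α', jj, hα'norm, by rw [hPdef] at hdet'; rw [hdet', hdet𝒩, one_mul]⟩

end FreeAssembly

end GKVVW
end Literature.Analysis.OperatorTheory
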